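import Literature.NumberTheory.GaloisRepresentations.GaloisCohomologyScalarAction
import Literature.NumberTheory.GaloisCohomology.KolyvaginSystems
import HarnessLib

/-!
# The scalar action on `H¹(K, M)`: stability of the tree's local conditions and Selmer groups

Topic `NumberTheory/GaloisRepresentations`. Companion of `GaloisCohomologyScalarAction.lean` (the `R`-module
structure `galoisCohomology.moduleH1 ρ hρ` on `H¹(K, M)` of an `R`-linear discrete Galois module, by
functoriality). B. Howard, Compositio Math. 140 (2004), Def. 1.1.1: «A local condition on `T` (over `K_v`) is
a choice of `R`-SUBMODULE of `H¹(K_v, T)`», Def. 1.1.10: the Selmer MODULE `H¹_𝓕(K, T)`. The tree's local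
conditions and Selmer groups are `ℤ`-linear (`AddSubgroup`s of the `ℤ`-linear `H¹`): this file proves that the
standard ones are STABLE under every `H¹(r•)` — the relaxed / strict conditions, the unramified condition
`DiscreteGaloisModule.unramifiedSubgroup` (a kernel of a restriction map), the `L`-transverse condition
`DiscreteGaloisModule.transverseSubgroup` (idem), the modified structures `𝓕^a_b(c)`
(`SelmerStructure.modify`), and the Selmer group `SelmerStructure.selmerGroup` of any place-wise stable
structure (localisation commutes with the action) — and packages them as `R`-submodules for the functorial
structure (`unramifiedSubmodule`, `transverseSubmodule`, `SelmerStructure.selmerSubmodule`), together with the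
induced `R`-module structure on the singular quotient `H¹(K_v, M)/H¹_ur` (`moduleSingularQuotient`). So Howard's
`R`-submodule local conditions are the tree's `ℤ`-linear ones, seen in ONE cohomology theory (cell
`pub/bsd-print-x9`, (W9); REF-131 (T4)). Definitions with bodies + their unfolding lemmas and theorems; no
named fact, nothing asserted, no `sorry`.

References: B. Howard, Compositio Math. 140 (2004), §1.1 (arXiv:1202.6340 §2.1: Def. 2.1.1 local
conditions, relaxed/strict/unramified/`L`-transverse; Def. 2.1.10 Selmer modules; Def. 2.2.2 `𝓕^a_b(c)`);
B. Mazur, K. Rubin, *Kolyvagin systems*, Mem. AMS 799 (2004), Def. 2.1.1; J.-P. Serre, *Galois Cohomology*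
(1997), I.§2.4.
-/

noncomputable section

open CategoryTheory
open scoped ContRepresentation

universe u v

namespace Literature.NumberTheory.GaloisRepresentations

open DiscreteGaloisModule galoisCohomology

variable {R : Type v} [Ring R]

/-! ## 1. Kernels of restriction maps: the transverse and unramified conditions -/

section Kernels

variable {F : Type u} [Field F] {M : Type u} [AddCommGroup M] [TopologicalSpace M] [DiscreteTopology M]
  [Module R M] {ρ : DiscreteGaloisModule F M}

/-- The kernel of the restriction `res_{L/F} : H¹(F, M) → H¹(L, M)` is stable under every `H¹(r•)`
(restriction commutes with the scalar action, `galoisCohomology.res_scalarMapH1`).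
[cite: SerreGaloisCohomology1997, Ch. I §2.4 (compatible pairs)] [cite: Howard2004HeegnerKolyvagin, Def. 1.1.1 (arXiv Def. 2.1.1, L-transverse condition)] -/
theorem galoisCohomology.scalarMapH1_mem_ker_res (hρ : ρ.IsScalarLinear R) (L : Type u) [Field L]
    [Algebra F L] (r : R) {x : galoisCohomology ρ 1} (hx : x ∈ (galoisCohomology.res ρ L 1).ker) :
    scalarMapH1 ρ hρ r x ∈ (galoisCohomology.res ρ L 1).ker :=
  scalarMapH1_mem_ker hρ (galoisCohomology.res ρ L 1)
    (fun r => scalarMapH1 (GaloisRep.restrictField L ρ) (hρ.restrictField L) r)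
    (fun r x => res_scalarMapH1 hρ L r x) r hx

/-- **The `L`-transverse condition is an `R`-submodule**: `H¹_{L-tr}(F, M) = ker (H¹(F, M) → H¹(L, M))`
(`DiscreteGaloisModule.transverseSubgroup`) is stable under every `H¹(r•)`.
[cite: Howard2004HeegnerKolyvagin, Def. 1.1.1 (arXiv Def. 2.1.1, «the L-transverse condition»)] -/
theorem DiscreteGaloisModule.scalarMapH1_mem_transverseSubgroup (hρ : ρ.IsScalarLinear R) (L : Type u)
    [Field L] [Algebra F L] (r : R) {x : galoisCohomology ρ 1} (hx : x ∈ ρ.transverseSubgroup L) :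
    scalarMapH1 ρ hρ r x ∈ ρ.transverseSubgroup L :=
  galoisCohomology.scalarMapH1_mem_ker_res hρ L r hx

/-- The `L`-transverse condition as an `R`-SUBMODULE of `H¹(F, M)` for the functorial structure
`moduleH1 ρ hρ`. [cite: Howard2004HeegnerKolyvagin, Def. 1.1.1 (arXiv Def. 2.1.1, «the L-transverse condition»)] -/
def DiscreteGaloisModule.transverseSubmodule (hρ : ρ.IsScalarLinear R) (L : Type u) [Field L]
    [Algebra F L] : letI := moduleH1 ρ hρ; Submodule R (galoisCohomology ρ 1) :=
  submoduleOfStable hρ (ρ.transverseSubgroup L)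
    (fun r _ hx => DiscreteGaloisModule.scalarMapH1_mem_transverseSubgroup hρ L r hx)

/-- Membership in `transverseSubmodule` is membership in `transverseSubgroup`.
[cite: Howard2004HeegnerKolyvagin, Def. 1.1.1 (arXiv Def. 2.1.1)] -/
@[simp]
theorem DiscreteGaloisModule.mem_transverseSubmodule_iff (hρ : ρ.IsScalarLinear R) (L : Type u) [Field L]
    [Algebra F L] (x : galoisCohomology ρ 1) :
    x ∈ ρ.transverseSubmodule hρ L ↔ x ∈ ρ.transverseSubgroup L :=
  Iff.rfl

variable [ValuativeRel F]

/-- **The unramified condition is an `R`-submodule**: `H¹_ur(F, M) = ker (H¹(F, M) → H¹(F^ur, M))`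
(`DiscreteGaloisModule.unramifiedSubgroup ρ 1`) is stable under every `H¹(r•)`.
[cite: Howard2004HeegnerKolyvagin, Def. 1.1.1 (arXiv Def. 2.1.1, «the unramified condition»)] -/
theorem DiscreteGaloisModule.scalarMapH1_mem_unramifiedSubgroup (hρ : ρ.IsScalarLinear R) (r : R)
    {x : galoisCohomology ρ 1} (hx : x ∈ ρ.unramifiedSubgroup 1) :
    scalarMapH1 ρ hρ r x ∈ ρ.unramifiedSubgroup 1 :=
  galoisCohomology.scalarMapH1_mem_ker_res hρ (IsNonarchimedeanLocalField.maxUnramified F) r hx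

/-- The unramified condition as an `R`-SUBMODULE of `H¹(F, M)` for the functorial structure `moduleH1 ρ hρ`.
[cite: Howard2004HeegnerKolyvagin, Def. 1.1.1 (arXiv Def. 2.1.1, «the unramified condition»)] -/
def DiscreteGaloisModule.unramifiedSubmodule (hρ : ρ.IsScalarLinear R) :
    letI := moduleH1 ρ hρ; Submodule R (galoisCohomology ρ 1) :=
  submoduleOfStable hρ (ρ.unramifiedSubgroup 1)
    (fun r _ hx => DiscreteGaloisModule.scalarMapH1_mem_unramifiedSubgroup hρ r hx)

/-- Membership in `unramifiedSubmodule` is membership in `unramifiedSubgroup ρ 1`.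
[cite: Howard2004HeegnerKolyvagin, Def. 1.1.1 (arXiv Def. 2.1.1)] -/
@[simp]
theorem DiscreteGaloisModule.mem_unramifiedSubmodule_iff (hρ : ρ.IsScalarLinear R)
    (x : galoisCohomology ρ 1) : x ∈ ρ.unramifiedSubmodule hρ ↔ x ∈ ρ.unramifiedSubgroup 1 :=
  Iff.rfl

/-- The underlying subgroup of `unramifiedSubmodule` is `unramifiedSubgroup ρ 1`.
[cite: Howard2004HeegnerKolyvagin, Def. 1.1.1 (arXiv Def. 2.1.1)] -/
theorem DiscreteGaloisModule.toAddSubgroup_unramifiedSubmodule (hρ : ρ.IsScalarLinear R) :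
    (letI := moduleH1 ρ hρ; (ρ.unramifiedSubmodule hρ).toAddSubgroup) = ρ.unramifiedSubgroup 1 :=
  rfl

/-- **The singular quotient `H¹_s(F, M) = H¹(F, M) / H¹_ur(F, M)` is an `R`-module**
(`DiscreteGaloisModule.SingularQuotient`, the quotient by an `R`-submodule); a `def`, to be installed with
`letI`. [cite: Howard2004HeegnerKolyvagin, Def. 1.1.1 (arXiv §2.1, «the singular quotient H¹_s(K_v,T)»)] -/
@[reducible]
def DiscreteGaloisModule.moduleSingularQuotient (hρ : ρ.IsScalarLinear R) :
    Module R ρ.SingularQuotient :=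
  letI := moduleH1 ρ hρ
  inferInstanceAs (Module R (galoisCohomology ρ 1 ⧸ ρ.unramifiedSubmodule hρ))

/-- The singular part map `H¹(F, M) → H¹_s(F, M)` commutes with the scalar actions:
`loc^s (r • x) = r • loc^s x`. [cite: Howard2004HeegnerKolyvagin, Def. 1.1.1 (arXiv §2.1, H¹_s)] -/
theorem DiscreteGaloisModule.singularMap_smul (hρ : ρ.IsScalarLinear R) (r : R) (x : galoisCohomology ρ 1) :
    ρ.singularMap (letI := moduleH1 ρ hρ; r • x) =
      (letI := ρ.moduleSingularQuotient hρ; r • ρ.singularMap x) :=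
  rfl

end Kernels

/-! ## 2. Selmer structures stable under the scalars; the Selmer group as an `R`-submodule -/

section Selmer

variable {K : Type u} [Field K] [NumberField K] {M : Type u} [AddCommGroup M] [TopologicalSpace M]
  [DiscreteTopology M] [Module R M] {ρ : DiscreteGaloisModule K M}

/-- A Selmer structure `𝓛` (a subgroup `𝓛_v ≤ H¹(K_v, M)` at every place) is **stable under the scalars**
when every `𝓛_v` is stable under every `H¹(r•)` on `H¹(K_v, M)` — i.e. every local condition is an
`R`-submodule, as in Howard's Def. 1.1.1. [cite: Howard2004HeegnerKolyvagin, Def. 1.1.1 and Def. 1.1.10 (arXiv Def. 2.1.1, 2.1.10)] -/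
def DiscreteGaloisModule.SelmerStructure.IsScalarStable (hρ : ρ.IsScalarLinear R) (𝓛 : SelmerStructure ρ) : Prop :=
  ∀ (v : NumberField.Place K) (r : R) {x : galoisCohomology (ρ.toLocal v) 1},
    x ∈ 𝓛 v → scalarMapH1 (ρ.toLocal v) (hρ.restrictField (NumberField.Place.Completion v)) r x ∈ 𝓛 v

/-- Unfolding `IsScalarStable`. [cite: Howard2004HeegnerKolyvagin, Def. 1.1.1 (arXiv Def. 2.1.1)] -/
theorem DiscreteGaloisModule.SelmerStructure.isScalarStable_iff (hρ : ρ.IsScalarLinear R) (𝓛 : SelmerStructure ρ) :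
    𝓛.IsScalarStable hρ ↔
      ∀ (v : NumberField.Place K) (r : R) {x : galoisCohomology (ρ.toLocal v) 1}, x ∈ 𝓛 v →
        scalarMapH1 (ρ.toLocal v) (hρ.restrictField (NumberField.Place.Completion v)) r x ∈ 𝓛 v :=
  Iff.rfl

/-- **The Selmer group of a scalar-stable structure is stable under every `H¹(r•)`**: localisation
commutes with the action (`galoisCohomology.localization_scalarMapH1`) and each `𝓛_v` is stable.
[cite: Howard2004HeegnerKolyvagin, Def. 1.1.10 (arXiv Def. 2.1.10, «the associated Selmer module»)]
[cite: SerreGaloisCohomology1997, Ch. I §2.4] -/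
theorem DiscreteGaloisModule.SelmerStructure.scalarMapH1_mem_selmerGroup (hρ : ρ.IsScalarLinear R) {𝓛 : SelmerStructure ρ}
    (h𝓛 : 𝓛.IsScalarStable hρ) (r : R) {x : galoisCohomology ρ 1} (hx : x ∈ 𝓛.selmerGroup) :
    scalarMapH1 ρ hρ r x ∈ 𝓛.selmerGroup := by
  rw [SelmerStructure.mem_selmerGroup_iff] at hx ⊢
  intro v
  rw [localization_scalarMapH1 hρ v r x]
  exact h𝓛 v r (hx v)

/-- **Howard's Selmer MODULE**: the Selmer group of a scalar-stable Selmer structure as an `R`-submodule of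
`H¹(K, M)` for the functorial structure `moduleH1 ρ hρ`.
[cite: Howard2004HeegnerKolyvagin, Def. 1.1.10 (arXiv Def. 2.1.10, «the associated Selmer module H¹_𝓕(K,T)»)] -/
def DiscreteGaloisModule.SelmerStructure.selmerSubmodule (hρ : ρ.IsScalarLinear R) (𝓛 : SelmerStructure ρ)
    (h𝓛 : 𝓛.IsScalarStable hρ) : letI := moduleH1 ρ hρ; Submodule R (galoisCohomology ρ 1) :=
  submoduleOfStable hρ 𝓛.selmerGroup (fun r _ hx => DiscreteGaloisModule.SelmerStructure.scalarMapH1_mem_selmerGroup hρ h𝓛 r hx)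

/-- Membership in `selmerSubmodule` is membership in `selmerGroup`.
[cite: Howard2004HeegnerKolyvagin, Def. 1.1.10 (arXiv Def. 2.1.10)] -/
@[simp]
theorem DiscreteGaloisModule.SelmerStructure.mem_selmerSubmodule_iff (hρ : ρ.IsScalarLinear R) (𝓛 : SelmerStructure ρ)
    (h𝓛 : 𝓛.IsScalarStable hρ) (x : galoisCohomology ρ 1) :
    x ∈ 𝓛.selmerSubmodule hρ h𝓛 ↔ x ∈ 𝓛.selmerGroup :=
  Iff.rfl

/-- The relaxed condition `⊤` and the strict condition `⊥` are stable (trivially): a structure all of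
whose local conditions are `⊤` or `⊥` is scalar-stable. Stated place-wise: `⊤` is stable.
[cite: Howard2004HeegnerKolyvagin, Def. 1.1.1 (arXiv Def. 2.1.1, «relaxed and strict conditions»)] -/
theorem DiscreteGaloisModule.SelmerStructure.scalarMapH1_mem_top (hρ : ρ.IsScalarLinear R) (v : NumberField.Place K) (r : R)
    (x : galoisCohomology (ρ.toLocal v) 1) :
    scalarMapH1 (ρ.toLocal v) (hρ.restrictField (NumberField.Place.Completion v)) r x ∈
      (⊤ : AddSubgroup (galoisCohomology (ρ.toLocal v) 1)) :=
  AddSubgroup.mem_top _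

/-- `⊥` is stable: `H¹(r•) 0 = 0`. [cite: Howard2004HeegnerKolyvagin, Def. 1.1.1 (arXiv Def. 2.1.1, «strict condition»)] -/
theorem DiscreteGaloisModule.SelmerStructure.scalarMapH1_mem_bot (hρ : ρ.IsScalarLinear R) (v : NumberField.Place K) (r : R)
    {x : galoisCohomology (ρ.toLocal v) 1} (hx : x ∈ (⊥ : AddSubgroup (galoisCohomology (ρ.toLocal v) 1))) :
    scalarMapH1 (ρ.toLocal v) (hρ.restrictField (NumberField.Place.Completion v)) r x ∈
      (⊥ : AddSubgroup (galoisCohomology (ρ.toLocal v) 1)) := by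
  rw [AddSubgroup.mem_bot] at hx ⊢
  rw [hx, map_zero]

/-- **Modified structures stay scalar-stable**: if `𝓕` and the transverse conditions `𝒯` are scalar-stable,
so is `𝓕^a_b(c)` (`SelmerStructure.modify`: relaxed at `a`, strict at `b`, `𝒯` at `c`, `𝓕` elsewhere) —
Howard's Def. 1.2.2 Selmer triple `(T, 𝓕^a_b(c), 𝓛(abc))` keeps `R`-submodule local conditions.
[cite: Howard2004HeegnerKolyvagin, Def. 1.2.2 (arXiv Def. 2.2.2, 𝓕^a_b(c))] -/
theorem DiscreteGaloisModule.SelmerStructure.IsScalarStable.modify (hρ : ρ.IsScalarLinear R) {𝓕 𝒯 : SelmerStructure ρ}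
    (h𝓕 : 𝓕.IsScalarStable hρ) (h𝒯 : 𝒯.IsScalarStable hρ)
    (a b c : Finset (IsDedekindDomain.HeightOneSpectrum (NumberField.RingOfIntegers K))) :
    (𝓕.modify 𝒯 a b c).IsScalarStable hρ := by
  intro v r x hx
  rcases v with w | q
  · rw [SelmerStructure.modify_inl] at hx ⊢
    exact h𝓕 (Sum.inl w) r hx
  · rw [SelmerStructure.modify_inr] at hx ⊢
    split_ifs at hx ⊢ with h1 h2 h3
    · exact AddSubgroup.mem_top _
    · exact DiscreteGaloisModule.SelmerStructure.scalarMapH1_mem_bot hρ (Sum.inr q) r hx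
    · exact h𝒯 (Sum.inr q) r hx
    · exact h𝓕 (Sum.inr q) r hx

end Selmer

end Literature.NumberTheory.GaloisRepresentations

end
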